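import Mathlib.Analysis.SpecialFunctions.Stirling
import Mathlib.Analysis.SpecialFunctions.Complex.LogBounds
import Mathlib.MeasureTheory.Integral.IntegralEqImproper
import Summits.RiemannHypothesis.RiemannHypothesis.Theorems.NymanBeurlingHeadTail
import HarnessLib

/-!
# RiemannHypothesis / Nyman–Beurling — `∫₀¹ {1/x}² dx = log 2π − γ − 1`: the Gram diagonal `G_{kk} = (log 2π − γ)/k`
and the value of `Q` (RH-FREE)

Column LI/NB of the RH ladder, rung L-P(P2) «structure of the NB minimiser», PROOF-OF-DATA for cell `pub/rh-li`
(theory memo `theory/TARGETS.md` §8.2, typed `NbQValue` in `theory/NBHeadTail.lean`; the diagonal of the Vasyunin /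
Landreau–Richard Gram formula used by every DATA lineage, DATA.md §L).  Classical real analysis:

* `FractSq.integral_nbI_fract_sq`: on the Farey cell `I_{n+1} = (1/(n+2), 1/(n+1)]`,
  `∫ {1/x}² = 1 − 2(n+1) log(1 + 1/(n+1)) + (n+1)/(n+2)`;
* `FractSq.sum_range_fractSqTerm`: the partial sums are `2N + 1 − H_N − 1/(N+1) − 2N log(N+1) + 2 log N!`;
* `FractSq.hasSum_fractSqTerm`: by Stirling (`Stirling.tendsto_stirlingSeq_sqrt_pi`) and `H_N − log(N+1) → γ` they converge to
  `log 2π − γ − 1`;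
* `integral_Ioc_fract_one_div_sq`: **`∫_{(0,1]} {1/x}² dx = log(2π) − γ − 1`** (classical);
* `nbGram0_zero_zero`, `nbGram_zero_zero` (`G_{11} = ‖ρ_1‖²_{L²(0,∞)} = log 2π − γ`), `nbGram_diag`
  (`G_{k+1,k+1} = (log 2π − γ)/(k+1)`, dilation) — the diagonal of the Gram matrix the DATA rung certifies
  (trace `(log 2π − γ)·H_N`);
* `integral_Ioc_nbStepH_sq` (`∫_{(0,1]} h² = Σ_n m_{n+1}²/((n+1)(n+2))`) and
  `nbQ_eq` = the closed form of `NbQValue`: **`Q = (log 2π − γ − 1) − Σ_{n≥1} m_n²/(n(n+1))`** (`{1/x} = h + q`, `q ⊥ h`).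

RH-FREE [rh-li-eng-3]: values of explicit integrals; nothing here bears on the truth of RH.  (The numerical enclosure
`|Q − 0.0803270395| ≤ 10⁻⁹` of `NbQValue` is NOT proved here.)
-/

noncomputable section

-- D-0017: `Summit.<S>.<S>.…` is the designed namespace of a single-problem summit.
set_option linter.dupNamespace false

open MeasureTheory Set Finset Filter

namespace Summit.RiemannHypothesis.RiemannHypothesis.Theorems.NbTheory

open Literature.NumberTheory.LFunctions Literature.NumberTheory.LFunctions.BaezDuarteOnlyIf

namespace FractSq

/-! ## The integral over one Farey cell -/

/-- The cell term `a_n = 1 − 2(n+1) log(1 + 1/(n+1)) + (n+1)/(n+2)`. -/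
lemma integral_nbI_fract_sq (n : ℕ) :
    ∫ x in nbI n, Int.fract (1 / x) ^ 2 =
      1 - 2 * ((n : ℝ) + 1) * Real.log (1 + 1 / ((n : ℝ) + 1)) + ((n : ℝ) + 1) / ((n : ℝ) + 2) := by
  have hab := nbI_endpoints_le n
  have hcongr : ∫ x in nbI n, Int.fract (1 / x) ^ 2 = ∫ x in nbI n, (x⁻¹ - ((n : ℝ) + 1)) ^ 2 := by
    refine setIntegral_congr_fun (measurableSet_nbI n) fun x hx ↦ ?_
    have hfl := floor_eq_of_mem_nbI hx
    have hx0 := pos_of_mem_nbI hx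
    have hz : ((⌊1 / x⌋ : ℤ) : ℝ) = (n : ℝ) + 1 := by
      have h := Int.natCast_floor_eq_floor (show (0 : ℝ) ≤ 1 / x by positivity)
      rw [hfl] at h
      rw [← h]; push_cast; ring
    rw [← Int.self_sub_floor, hz, one_div]
  rw [hcongr]
  unfold nbI
  rw [← intervalIntegral.integral_of_le hab]
  have ha0 : (0 : ℝ) < 1 / ((n : ℝ) + 2) := by positivity
  have hderiv : ∀ x ∈ Set.uIcc (1 / ((n : ℝ) + 2)) (1 / ((n : ℝ) + 1)),
      HasDerivAt (fun y : ℝ ↦ -y⁻¹ - 2 * ((n : ℝ) + 1) * Real.log y + ((n : ℝ) + 1) ^ 2 * y)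
        ((x⁻¹ - ((n : ℝ) + 1)) ^ 2) x := by
    intro x hx
    rw [Set.uIcc_of_le hab] at hx
    have hx0 : x ≠ 0 := (lt_of_lt_of_le ha0 hx.1).ne'
    have h1 : HasDerivAt (fun y : ℝ ↦ y⁻¹) (-(x ^ 2)⁻¹) x := hasDerivAt_inv hx0
    have h2 : HasDerivAt Real.log x⁻¹ x := Real.hasDerivAt_log hx0
    have h := (h1.neg.sub (h2.const_mul (2 * ((n : ℝ) + 1)))).add
      ((hasDerivAt_id' x).const_mul (((n : ℝ) + 1) ^ 2))
    refine h.congr_deriv ?_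
    field_simp
    ring
  have hint : IntervalIntegrable (fun x : ℝ ↦ (x⁻¹ - ((n : ℝ) + 1)) ^ 2) volume
      (1 / ((n : ℝ) + 2)) (1 / ((n : ℝ) + 1)) := by
    refine (continuousOn_of_forall_continuousAt fun x hx ↦ ?_).intervalIntegrable
    rw [Set.uIcc_of_le hab] at hx
    have hx0 : x ≠ 0 := (lt_of_lt_of_le ha0 hx.1).ne'
    fun_prop (disch := assumption)
  rw [intervalIntegral.integral_eq_sub_of_hasDerivAt hderiv hint]
  have hlog : Real.log (1 / ((n : ℝ) + 1)) - Real.log (1 / ((n : ℝ) + 2)) = Real.log (1 + 1 / ((n : ℝ) + 1)) := by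
    rw [← Real.log_div (by positivity) (by positivity)]
    congr 1
    field_simp
    ring
  have hlin : -(1 / ((n : ℝ) + 1))⁻¹ - 2 * ((n : ℝ) + 1) * Real.log (1 / ((n : ℝ) + 1))
        + ((n : ℝ) + 1) ^ 2 * (1 / ((n : ℝ) + 1))
      - (-(1 / ((n : ℝ) + 2))⁻¹ - 2 * ((n : ℝ) + 1) * Real.log (1 / ((n : ℝ) + 2))
        + ((n : ℝ) + 1) ^ 2 * (1 / ((n : ℝ) + 2))) =
      ((1 / ((n : ℝ) + 2))⁻¹ - (1 / ((n : ℝ) + 1))⁻¹)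
        + ((n : ℝ) + 1) ^ 2 * (1 / ((n : ℝ) + 1) - 1 / ((n : ℝ) + 2))
        - 2 * ((n : ℝ) + 1) * (Real.log (1 / ((n : ℝ) + 1)) - Real.log (1 / ((n : ℝ) + 2))) := by ring
  rw [hlin, hlog]
  field_simp
  ring

/-- `{1/x}²` is integrable on `(0,1]`. -/
lemma integrableOn_fract_sq : IntegrableOn (fun x : ℝ ↦ Int.fract (1 / x) ^ 2) (Set.Ioc (0 : ℝ) 1) :=
  integrableOn_Ioc_of_bounded ((measurable_fract.comp (by fun_prop : Measurable fun x : ℝ ↦ 1 / x)).pow_const 2)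
    (M := 1) fun x ↦ by
      rw [abs_of_nonneg (sq_nonneg _)]
      have h0 := Int.fract_nonneg (1 / x)
      have h1 := (Int.fract_lt_one (1 / x)).le
      nlinarith

/-- The cell terms are non-negative (they are integrals of a square). -/
lemma fractSqTerm_nonneg (n : ℕ) :
    0 ≤ 1 - 2 * ((n : ℝ) + 1) * Real.log (1 + 1 / ((n : ℝ) + 1)) + ((n : ℝ) + 1) / ((n : ℝ) + 2) := by
  rw [← integral_nbI_fract_sq]
  exact setIntegral_nonneg (measurableSet_nbI n) fun x _ ↦ sq_nonneg _

/-! ## Partial sums in closed form and their limit (Stirling) -/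

/-- `Σ_{n<N} a_n = 2N + 1 − H_N − 1/(N+1) − 2N log(N+1) + 2 log N!`. -/
lemma sum_range_fractSqTerm (N : ℕ) :
    ∑ n ∈ Finset.range N,
        (1 - 2 * ((n : ℝ) + 1) * Real.log (1 + 1 / ((n : ℝ) + 1)) + ((n : ℝ) + 1) / ((n : ℝ) + 2)) =
      2 * N + 1 - (harmonic N : ℝ) - 1 / ((N : ℝ) + 1) - 2 * N * Real.log ((N : ℝ) + 1) +
        2 * Real.log (N.factorial : ℝ) := by
  induction N with
  | zero => simp
  | succ N ih =>
    rw [Finset.sum_range_succ, ih, harmonic_succ, Nat.factorial_succ, Nat.cast_mul,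
      Real.log_mul (by positivity) (by positivity)]
    push_cast
    have h1 : Real.log (1 + 1 / ((N : ℝ) + 1)) = Real.log ((N : ℝ) + 1 + 1) - Real.log ((N : ℝ) + 1) := by
      rw [← Real.log_div (by positivity) (by positivity)]
      congr 1
      field_simp
    rw [h1]
    field_simp
    ring

/-- For `N ≥ 1` the partial sum, rewritten through `log N! = log stirlingSeq N + ½ log(2N) + N log(N/e)`. -/
lemma sum_range_fractSqTerm_eq_stirling {N : ℕ} (hN : 1 ≤ N) :
    ∑ n ∈ Finset.range N,
        (1 - 2 * ((n : ℝ) + 1) * Real.log (1 + 1 / ((n : ℝ) + 1)) + ((n : ℝ) + 1) / ((n : ℝ) + 2)) =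
      1 + Real.log 2 - ((harmonic N : ℝ) - Real.log ((N : ℝ) + 1)) - 1 / ((N : ℝ) + 1)
        - (2 * (N * Real.log (1 + 1 / (N : ℝ))) + Real.log (1 + 1 / (N : ℝ)))
        + 2 * Real.log (Stirling.stirlingSeq N) := by
  have hN0 : (0 : ℝ) < N := by exact_mod_cast hN
  rw [sum_range_fractSqTerm, Stirling.log_stirlingSeq_formula, Real.log_div hN0.ne' (Real.exp_pos 1).ne',
    Real.log_exp, Real.log_mul two_ne_zero hN0.ne']
  have h1 : Real.log (1 + 1 / (N : ℝ)) = Real.log ((N : ℝ) + 1) - Real.log N := by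
    rw [← Real.log_div (by positivity) hN0.ne']
    congr 1
    field_simp
  rw [h1]
  ring

/-- The partial sums tend to `log 2π − γ − 1`. -/
lemma tendsto_sum_range_fractSqTerm :
    Tendsto (fun N : ℕ ↦ ∑ n ∈ Finset.range N,
        (1 - 2 * ((n : ℝ) + 1) * Real.log (1 + 1 / ((n : ℝ) + 1)) + ((n : ℝ) + 1) / ((n : ℝ) + 2)))
      atTop (nhds (Real.log (2 * Real.pi) - Real.eulerMascheroniConstant - 1)) := by
  -- the limits of the pieces
  have hγ : Tendsto (fun N : ℕ ↦ (harmonic N : ℝ) - Real.log ((N : ℝ) + 1)) atTop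
      (nhds Real.eulerMascheroniConstant) := Real.tendsto_harmonic_sub_log_add_one
  have hinv : Tendsto (fun N : ℕ ↦ 1 / ((N : ℝ) + 1)) atTop (nhds 0) := tendsto_one_div_add_atTop_nhds_zero_nat
  have hNlog : Tendsto (fun N : ℕ ↦ (N : ℝ) * Real.log (1 + 1 / (N : ℝ))) atTop (nhds 1) :=
    (Real.tendsto_mul_log_one_add_div_atTop 1).comp tendsto_natCast_atTop_atTop
  have hlog : Tendsto (fun N : ℕ ↦ Real.log (1 + 1 / (N : ℝ))) atTop (nhds 0) := by
    have h1 : Tendsto (fun N : ℕ ↦ 1 + 1 / (N : ℝ)) atTop (nhds 1) := by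
      simpa using tendsto_const_nhds.add (tendsto_const_div_atTop_nhds_zero_nat (1 : ℝ))
    have h2 := (Real.continuousAt_log one_ne_zero).tendsto.comp h1
    simpa [Function.comp_def, Real.log_one] using h2
  have hstir : Tendsto (fun N : ℕ ↦ Real.log (Stirling.stirlingSeq N)) atTop (nhds (Real.log (Real.sqrt Real.pi))) :=
    (Real.continuousAt_log (Real.sqrt_pos.2 Real.pi_pos).ne').tendsto.comp Stirling.tendsto_stirlingSeq_sqrt_pi
  have hlim : Tendsto (fun N : ℕ ↦ 1 + Real.log 2 - ((harmonic N : ℝ) - Real.log ((N : ℝ) + 1)) - 1 / ((N : ℝ) + 1)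
        - (2 * (N * Real.log (1 + 1 / (N : ℝ))) + Real.log (1 + 1 / (N : ℝ)))
        + 2 * Real.log (Stirling.stirlingSeq N)) atTop
      (nhds (1 + Real.log 2 - Real.eulerMascheroniConstant - 0 - (2 * 1 + 0) + 2 * Real.log (Real.sqrt Real.pi))) :=
    (((tendsto_const_nhds.sub hγ).sub hinv).sub ((hNlog.const_mul 2).add hlog)).add (hstir.const_mul 2)
  have hval : 1 + Real.log 2 - Real.eulerMascheroniConstant - 0 - (2 * 1 + 0) + 2 * Real.log (Real.sqrt Real.pi) =
      Real.log (2 * Real.pi) - Real.eulerMascheroniConstant - 1 := by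
    rw [Real.log_sqrt Real.pi_pos.le, Real.log_mul two_ne_zero Real.pi_pos.ne']
    ring
  rw [hval] at hlim
  refine hlim.congr' ?_
  filter_upwards [eventually_ge_atTop 1] with N hN
  exact (sum_range_fractSqTerm_eq_stirling hN).symm

/-- `Σ_n a_n = log 2π − γ − 1`. -/
lemma hasSum_fractSqTerm :
    HasSum (fun n : ℕ ↦ 1 - 2 * ((n : ℝ) + 1) * Real.log (1 + 1 / ((n : ℝ) + 1)) + ((n : ℝ) + 1) / ((n : ℝ) + 2))
      (Real.log (2 * Real.pi) - Real.eulerMascheroniConstant - 1) := by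
  rw [hasSum_iff_tendsto_nat_of_nonneg fractSqTerm_nonneg]
  exact tendsto_sum_range_fractSqTerm

end FractSq

open FractSq

/-! ## The classical integral and the Gram diagonal -/

/-- **`∫_{(0,1]} {1/x}² dx = log(2π) − γ − 1`** (classical; RH-FREE). -/
theorem integral_Ioc_fract_one_div_sq :
    ∫ x in Set.Ioc (0 : ℝ) 1, Int.fract (1 / x) ^ 2 = Real.log (2 * Real.pi) - Real.eulerMascheroniConstant - 1 := by
  have hint := integrableOn_fract_sq
  rw [Ioc_eq_iUnion_nbI] at hint ⊢
  rw [integral_iUnion measurableSet_nbI pairwise_disjoint_nbI hint]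
  simp_rw [integral_nbI_fract_sq]
  exact hasSum_fractSqTerm.tsum_eq

/-- `G⁰_{11} = ∫_{(0,1]} ρ_1² = log(2π) − γ − 1`. -/
theorem nbGram0_zero_zero : nbGram0 0 0 = Real.log (2 * Real.pi) - Real.eulerMascheroniConstant - 1 := by
  rw [← integral_Ioc_fract_one_div_sq, nbGram0]
  refine setIntegral_congr_fun measurableSet_Ioc fun x _ ↦ ?_
  simp [nbRho, sq]

/-- **`G_{11} = ‖ρ_1‖²_{L²(0,∞)} = log(2π) − γ`** (RH-FREE; the `k = 1` diagonal entry of the Gram matrix of the DATA rung). -/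
theorem nbGram_zero_zero : nbGram 0 0 = Real.log (2 * Real.pi) - Real.eulerMascheroniConstant := by
  rw [nbGramSplit, nbGram0_zero_zero]
  norm_num

/-- Dilation: `ρ_{k+1}(x) = ρ_1((k+1)x)`. -/
lemma nbRho_eq_nbRho_zero_mul (k : ℕ) (x : ℝ) : nbRho k x = nbRho 0 (((k : ℝ) + 1) * x) := by
  simp [nbRho]

/-- **The Gram diagonal: `G_{k+1,k+1} = (log 2π − γ)/(k+1)`** (RH-FREE; dilation `x ↦ (k+1)x`).  Hence
`tr G_N = (log 2π − γ)·H_N`. -/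
theorem nbGram_diag (k : ℕ) :
    nbGram k k = (Real.log (2 * Real.pi) - Real.eulerMascheroniConstant) / ((k : ℝ) + 1) := by
  have hk : (0 : ℝ) < (k : ℝ) + 1 := by positivity
  rw [← nbGram_zero_zero, nbGram, nbGram]
  simp_rw [nbRho_eq_nbRho_zero_mul k]
  rw [integral_comp_mul_left_Ioi (fun u ↦ nbRho 0 u * nbRho 0 u) 0 hk, mul_zero, smul_eq_mul]
  field_simp

/-! ## The value of `Q` -/

/-- `∫_{(0,1]} h² = Σ_n m_{n+1}²/((n+1)(n+2))` (`h` is the constant `m_{n+1}` on the cell `I_{n+1}`). -/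
theorem integral_Ioc_nbStepH_sq :
    ∫ x in Set.Ioc (0 : ℝ) 1, nbStepH x ^ 2 =
      ∑' n : ℕ, nbFareyMean (n + 1) ^ 2 / (((n : ℝ) + 1) * ((n : ℝ) + 2)) := by
  have hint : IntegrableOn (fun x ↦ nbStepH x ^ 2) (Set.Ioc (0 : ℝ) 1) :=
    integrableOn_Ioc_of_bounded (measurable_nbStepH.pow_const 2) (M := 1) fun x ↦ by
      rw [abs_pow]
      have := abs_nbStepH_le x
      nlinarith [abs_nonneg (nbStepH x)]
  rw [Ioc_eq_iUnion_nbI] at hint ⊢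
  rw [integral_iUnion measurableSet_nbI pairwise_disjoint_nbI hint]
  refine tsum_congr fun n ↦ ?_
  have hcongr : ∫ x in nbI n, nbStepH x ^ 2 = ∫ x in nbI n, nbFareyMean (n + 1) ^ 2 := by
    refine setIntegral_congr_fun (measurableSet_nbI n) fun x hx ↦ ?_
    have hx' := nbI_subset n hx
    simp only [nbStepH, hx'.1, hx'.2, and_self, if_true, floor_eq_of_mem_nbI hx]
  rw [hcongr, setIntegral_const, smul_eq_mul]
  unfold nbI
  rw [Real.volume_real_Ioc_of_le (nbI_endpoints_le n)]
  field_simp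
  ring

/-- `∫_{(0,1]} {1/x}² = ∫_{(0,1]} h² + Q` (`{1/x} = h + q` on `(0,1]` with `q ⊥ h`). -/
theorem integral_Ioc_fract_sq_eq_add_nbQ :
    ∫ x in Set.Ioc (0 : ℝ) 1, Int.fract (1 / x) ^ 2 = (∫ x in Set.Ioc (0 : ℝ) 1, nbStepH x ^ 2) + nbQ := by
  -- `q ⊥ h`
  have horth : ∫ x in Set.Ioc (0 : ℝ) 1, nbStepH x * nbFluct x = 0 := by
    have h := nbFluctStepOrthogonal_holds nbFareyMean ⟨1, fun n ↦ by
      rw [abs_of_nonneg (nbFareyMean_nonneg n)]; exact nbFareyMean_le_one n⟩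
    refine Eq.trans (setIntegral_congr_fun measurableSet_Ioc fun x hx ↦ ?_) h
    simp only [nbStepH, hx.1, hx.2, and_self, if_true]
  have hh2 : IntegrableOn (fun x ↦ nbStepH x ^ 2) (Set.Ioc (0 : ℝ) 1) :=
    integrableOn_Ioc_of_bounded (measurable_nbStepH.pow_const 2) (M := 1) fun x ↦ by
      rw [abs_pow]
      have := abs_nbStepH_le x
      nlinarith [abs_nonneg (nbStepH x)]
  have hhq : IntegrableOn (fun x ↦ nbStepH x * nbFluct x) (Set.Ioc (0 : ℝ) 1) :=
    integrableOn_Ioc_of_bounded (measurable_nbStepH.mul measurable_nbFluct) (M := 2) fun x ↦ by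
      rw [abs_mul]
      have h1 := abs_nbStepH_le x
      have h2 := abs_nbFluct_le x
      nlinarith [abs_nonneg (nbStepH x), abs_nonneg (nbFluct x)]
  have hq2 : IntegrableOn (fun x ↦ nbFluct x ^ 2) (Set.Ioc (0 : ℝ) 1) :=
    integrableOn_Ioc_of_bounded (measurable_nbFluct.pow_const 2) (M := 4) fun x ↦ by
      rw [abs_pow]
      have := abs_nbFluct_le x
      nlinarith [abs_nonneg (nbFluct x)]
  have hpt : ∀ x ∈ Set.Ioc (0 : ℝ) 1,
      Int.fract (1 / x) ^ 2 = (nbStepH x ^ 2 + 2 * (nbStepH x * nbFluct x)) + nbFluct x ^ 2 := by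
    intro x hx
    have : Int.fract (1 / x) = nbStepH x + nbFluct x := by
      simp only [nbFluct, hx.1, hx.2, and_self, if_true]; ring
    rw [this]; ring
  have hA : IntegrableOn (fun x ↦ nbStepH x ^ 2 + 2 * (nbStepH x * nbFluct x)) (Set.Ioc (0 : ℝ) 1) :=
    hh2.add (hhq.const_mul 2)
  rw [setIntegral_congr_fun measurableSet_Ioc hpt, integral_add hA hq2,
    integral_add hh2 (hhq.const_mul 2), integral_const_mul, horth, mul_zero, add_zero]
  rfl

/-- **`NbQValue`, closed form (RH-FREE): `Q = (log 2π − γ − 1) − Σ_{n≥0} m_{n+1}²/((n+1)(n+2))`.** -/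
theorem nbQ_eq :
    nbQ = (Real.log (2 * Real.pi) - Real.eulerMascheroniConstant - 1)
      - ∑' n : ℕ, nbFareyMean (n + 1) ^ 2 / (((n : ℝ) + 1) * ((n : ℝ) + 2)) := by
  rw [← integral_Ioc_fract_one_div_sq, ← integral_Ioc_nbStepH_sq, integral_Ioc_fract_sq_eq_add_nbQ]
  ring

end Summit.RiemannHypothesis.RiemannHypothesis.Theorems.NbTheory

end
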